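import Summits.CriticalPhenomena.PercolationContinuityZ3.Theorems.PercNearOneGluingNoHeavyQuantTwoPointPairRouteBall
import HarnessLib

/-!
# QUANT lane / PAPER-2 rate track (ARM-2, gen 9): THE FREE-PARTNER PAIR ROUTE WITH THE DUMINIL-COPIN–TASSION INPUT `φ_{p_c} ≥ 1`
# — `q² ≤ τ_{p_c}(0,v) + Rf′(D,ℓ)/q_c(D)` for EVERY `v ∈ Λ_D`; X_A ⟹ power law with exponent `min(a,1)/(8d²+8)` (`d = 3`: `a′/80`)

builds on p205010 (kernel theorem, internal audit signed; external expert review pending)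

Cell `prim-quant`, seat `prim-quant-arm-2` (constants bookkeeper), memo `RATE-CONSTANTS.md` §5.6.  Proof-only file composing ARM-2 gen 9's
pair route (`…QuantTwoPointPairRoute`: pair Harris square; `…PairRouteBall`: free partner) with ARM-1 gen 9's `ε`-free input at `p_c`
(`…QuantCerfZoneCritical`: `Quant.bconn_criticalProbI_two_point_lower`, Cerf's Lemma 6.1 fed by `φ_{p_c}(Λ_m) ≥ 1`).

THE POINT.  In `…PairRouteBall` the connection lower bound for the free pair `(0,v)` inside `Λ_{2D}` carried the factor `θ_D^{2d}`, cancelled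
against `q^{2d}` at the price of a `(2d+2)`-nd root.  At `p_c` the Duminil-Copin–Tassion input gives the chained lower bound WITHOUT `θ_D`:
`P_{p_c}(0 ↔ v in Λ_{2D}) ≥ q_c(D) = p_c^{d+2}(p_c((1/2d)/(2d(2D+1)^{d−1}))²)^d`, so the pair Harris square and Lemma 7.1 (`k = D`) give
directly, for `d ≥ 2`, `D ≥ 1`, `ℓ ≥ D+3` and EVERY `v ∈ Λ_D` (`Quant.real_boxCrossing_criticalProbI_sq_le_pair_crit`):

  **`q² ≤ τ_{p_c}(0,v) + Rf′(D,ℓ)/q_c(D)`**,  `q = P_{p_c}(boxCrossing d 0 (D+ℓ+D+1))`,  `Rf′ = (1+|E(Λ_{2D+1})|/p_c)|Λ_{2D+1}|Σ_i P_{p_c}(edgeTwoArms i (ℓ−D−2))`,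

explicitly (`…_sq_le_pair_crit_explicit`) `q² ≤ τ_{p_c}(0,v) + 5d³(2d)^{6d+2}κ_d(4D+3)^{2d²}(1+log m)/√m` (`ℓ = m+D+2`, `κ_d = aknKappa d (1/(2d))`)
— a SQUARE root instead of the `8`-th root.  CONSEQUENCE (`Quant.oneArmPolyDecayAtCritical_of_ballTwoPoint_pair_crit`): with `D = ⌊M^ρ⌋`,
`ρ = θ = 1/(4d²+4)` (`2d²ρ + θ − 1/2 = −ρ`), X_A(d,a,C) ⟹ **`OneArmPolyDecayAtCritical d (a′/(8d²+8)) (195^c·√(2C + K″_d))`**,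
`K″_d = 5√2·d³(2d)^{6d+2}(4d²+4)·7^{2d²}·κ_d` — `d = 3`: **`a′/80`** (`d = 4,5,6`: `a′/136, /208, /296`); the lane's other X_A rows: `a′/440`
(packaged zone), `a′/250` (free ε), `≈ a′/100` (ARM-1 g9, Cerf zone with `φ`), `a′/90` (ARM-2 g9, pair + `θ_D`-bootstrap, constant `2^66`).
The price is the constant: `√K″_3 ≈ 2^{263}` (no root compresses `κ_3 ≈ 2^{409}`); `ℤ³` numerals in `…PairRouteBallCritZ3`.
WHERE IT STILL LOSES (RATE-CONSTANTS §5.6): AKN's two-arms exponent `1/2` (truth `≈ 1.86`), Lemma 7.1's `D^{2d}`, the chaining degree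
`2d(d−1)`.  HONEST FRAMING: an implication from the OPEN input X_A (⟺ (T1); true `d ≥ 11`, open `3 ≤ d ≤ 10`); class log*, display
`1 − 2⁻¹⁹⁸⁶`, honest sentence UNCHANGED.
[cite: Cerf2015, Lemma 6.1, Lemma 7.1 and §10] [cite: DuminilcopinKozmaTassion2020, §7 (38)–(40)] [cite: DuminilCopinTassionEM2016, Thm. 1.1]
[cite: KozmaNachmias2011, Lemma 3.1] [cite: HeydenreichVanDerHofstad2017, Open Problem 10.1]
-/

noncomputable section

namespace Summit.CriticalPhenomena.PercolationContinuityZ3.Theorems.Quant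

open MeasureTheory Literature.Probability.Percolation Literature.Probability.LatticeModels
open Summit.CriticalPhenomena.PercolationContinuityZ3.Theorems.SurfaceTension
open Literature.Probability.Percolation.AKN
open scoped Classical

variable {d : ℕ}

/-! ## The square inequality at `p_c` for every partner -/

/-- **PAIR ROUTE WITH THE `φ_{p_c} ≥ 1` INPUT (structural, `d ≥ 2`, `D ≥ 1`, `ℓ ≥ D+3`, `v ∈ Λ_D`).**
`q² ≤ τ_{p_c}(0,v) + Rf′(D,ℓ)/q_c(D)` with `q = P_{p_c}(boxCrossing d 0 (D+ℓ+D+1))`,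
`Rf′ = (1+|E(Λ_{2D+1})|/p_c)·|Λ_{2D+1}|·Σ_i P_{p_c}(edgeTwoArms i (ℓ−D−2))` and `q_c(D) = p_c^{d+2}(p_c((1/2d)/(2d(2D+1)^{d−1}))²)^d`:
pair Harris square, Lemma 7.1 at `k = D`, and `P_{p_c}(0 ↔ v in Λ_{2D}) ≥ q_c(D)` (`Quant.bconn_criticalProbI_two_point_lower`, ARM-1 gen 9).
builds on p205010 (kernel theorem, internal audit signed; external expert review pending).
[cite: Cerf2015, Lemma 6.1, Lemma 7.1 and §10] [cite: DuminilCopinTassionEM2016, Thm. 1.1] [cite: DuminilcopinKozmaTassion2020, §7 (40)] -/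
theorem real_boxCrossing_criticalProbI_sq_le_pair_crit (hd : 2 ≤ d) {D ℓ : ℕ} (hℓ : D + 3 ≤ ℓ) {v : Site d} (hv : v ∈ box d D) :
    (bondPercolation (zdGraph d) (criticalProbI d)).real (boxCrossing d 0 (D + ℓ + D + 1)) ^ 2 ≤
      tau d (criticalProbI d) 0 v +
        (1 + (edgesIn (zdGraph d) (box d (2 * D + 1))).card / (criticalProbI d : ℝ)) *
            ((box d (2 * D + 1)).card *
              ∑ i : Fin d, (bondPercolation (zdGraph d) (criticalProbI d)).real (edgeTwoArms i (ℓ - D - 2))) /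
          ((criticalProbI d : ℝ) ^ (d + 2) *
            ((criticalProbI d : ℝ) * ((1 / (2 * (d : ℝ))) / (2 * d * (2 * D + 1) ^ (d - 1))) ^ 2) ^ d) := by
  have hd1 : 1 ≤ d := le_trans (by norm_num) hd
  have hd0 : (0 : ℝ) < d := by exact_mod_cast (show 0 < d by omega)
  have hp0 : 0 < (criticalProbI d : ℝ) := lt_of_lt_of_le (by positivity) (inv_two_mul_le_criticalProbI hd1)
  set μ := bondPercolation (zdGraph d) (criticalProbI d) with hμ
  obtain ⟨A, hA⟩ : ∃ A : ℝ, A = μ.real (twoArmsBox D ℓ 0 v) := ⟨_, rfl⟩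
  obtain ⟨B, hB⟩ : ∃ B : ℝ, B = μ.real (bconn (box d (2 * D)) 0 v) := ⟨_, rfl⟩
  obtain ⟨Rf, hRf⟩ : ∃ Rf : ℝ, Rf = (1 + (edgesIn (zdGraph d) (box d (2 * D + 1))).card / (criticalProbI d : ℝ)) *
      ((box d (2 * D + 1)).card * ∑ i : Fin d, μ.real (edgeTwoArms i (ℓ - D - 2))) := ⟨_, rfl⟩
  obtain ⟨qc, hqc⟩ : ∃ qc : ℝ, qc = (criticalProbI d : ℝ) ^ (d + 2) *
      ((criticalProbI d : ℝ) * ((1 / (2 * (d : ℝ))) / (2 * d * (2 * D + 1) ^ (d - 1))) ^ 2) ^ d := ⟨_, rfl⟩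
  rw [← hRf, ← hqc]
  have hA0 : 0 ≤ A := by rw [hA]; exact measureReal_nonneg
  have hqc0 : 0 < qc := by rw [hqc]; positivity
  -- (1) pair Harris square
  have hsq : μ.real (boxCrossing d 0 (D + ℓ + D + 1)) ^ 2 ≤ tau d (criticalProbI d) 0 v + A := by
    rw [hA]; exact real_boxCrossing_zero_sq_le_tau_add_twoArmsBox _ hv
  -- (2) Lemma 7.1 with `k = D`
  have h71 : A * B ≤ Rf := by
    have h := real_twoArmsBox_mul_le (criticalProbI d) hp0 (n := D) (k := D) (ℓ := ℓ) hℓ (zero_mem_box d D) hv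
    rw [← two_mul] at h
    rw [hA, hB, hRf]; exact h
  -- (3) the `ε`-free chained two-point lower bound at `p_c`
  have hqcB : qc ≤ B := by rw [hqc, hB]; exact bconn_criticalProbI_two_point_lower hd (zero_mem_box d D) hv
  have hAle : A ≤ Rf / qc := by
    rw [le_div_iff₀ hqc0]
    calc A * qc ≤ A * B := mul_le_mul_of_nonneg_left hqcB hA0
      _ ≤ Rf := h71
  linarith

/-- **The square inequality at `p_c` with every constant explicit** (`d ≥ 2`, `D ≥ 1`, `m ≥ 1`, `v ∈ Λ_D`):
`q² ≤ τ_{p_c}(0,v) + 5d³(2d)^{6d+2}·κ_d·(4D+3)^{2d²}·(1+log m)/√m`, `q = P_{p_c}(boxCrossing d 0 (D+(m+D+2)+D+1))`, `κ_d = aknKappa d (1/(2d))`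
(`1/q_c(D) = (2d)^{2d}(2d(2D+1)^{d−1})^{2d}/p_c^{2d+2} ≤ (2d)^{6d+2}(4D+3)^{2d(d−1)}`, `Rf′ ≤ 5d³κ_d(4D+3)^{2d}(1+log m)/√m`).
builds on p205010 (kernel theorem, internal audit signed; external expert review pending).
[cite: Cerf2015, Prop. 5.2, Lemma 6.1 and Lemma 7.1] [cite: DuminilcopinKozmaTassion2020, §7 (38)–(40)] [cite: DuminilCopinTassionEM2016, Thm. 1.1] -/
theorem real_boxCrossing_criticalProbI_sq_le_pair_crit_explicit (hd : 2 ≤ d) {D m : ℕ} (hD : 1 ≤ D) (hm : 1 ≤ m) {v : Site d}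
    (hv : v ∈ box d D) :
    (bondPercolation (zdGraph d) (criticalProbI d)).real (boxCrossing d 0 (D + (m + D + 2) + D + 1)) ^ 2 ≤
      tau d (criticalProbI d) 0 v +
        5 * (d : ℝ) ^ 3 * (2 * (d : ℝ)) ^ (6 * d + 2) * aknKappa d (1 / (2 * (d : ℝ))) * (4 * (D : ℝ) + 3) ^ (2 * d ^ 2) *
          ((1 + Real.log m) / Real.sqrt m) := by
  have hd1 : 1 ≤ d := le_trans (by norm_num) hd
  have hd0 : (0 : ℝ) < d := by exact_mod_cast (show 0 < d by omega)
  have hδ0 : (0 : ℝ) < 1 / (2 * (d : ℝ)) := by positivity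
  have hδ : 1 / (2 * (d : ℝ)) ≤ 1 / 2 := by
    have : (1 : ℝ) ≤ d := by exact_mod_cast hd1
    exact one_div_le_one_div_of_le (by norm_num) (by linarith)
  have hlo := inv_two_mul_le_criticalProbI hd1
  have hhi := criticalProbI_le_one_sub_inv_two_mul hd
  have hp0 : 0 < (criticalProbI d : ℝ) := lt_of_lt_of_le hδ0 hlo
  set μ := bondPercolation (zdGraph d) (criticalProbI d) with hμ
  have h := real_boxCrossing_criticalProbI_sq_le_pair_crit hd (by omega : D + 3 ≤ m + D + 2) hv
  have e : m + D + 2 - D - 2 = m := by omega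
  rw [e] at h
  refine h.trans (add_le_add le_rfl ?_)
  -- names
  set κ := aknKappa d (1 / (2 * (d : ℝ))) with hκ
  set X : ℝ := 4 * (D : ℝ) + 3 with hX
  set L : ℝ := (1 + Real.log m) / Real.sqrt m with hL
  set p : ℝ := (criticalProbI d : ℝ) with hp
  obtain ⟨B, hB⟩ : ∃ B : ℝ, B = ((box d (2 * D + 1)).card : ℝ) := ⟨_, rfl⟩
  obtain ⟨E, hE⟩ : ∃ E : ℝ, E = ((edgesIn (zdGraph d) (box d (2 * D + 1))).card : ℝ) := ⟨_, rfl⟩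
  obtain ⟨S, hS⟩ : ∃ S : ℝ, S = ∑ i : Fin d, μ.real (edgeTwoArms i m) := ⟨_, rfl⟩
  obtain ⟨c₀, hc₀⟩ : ∃ c₀ : ℝ, c₀ = 2 * d * (2 * (D : ℝ) + 1) ^ (d - 1) := ⟨_, rfl⟩
  rw [← hB, ← hE, ← hS, ← hc₀]
  have hX1 : 1 ≤ X := by rw [hX]; have : (0 : ℝ) ≤ D := Nat.cast_nonneg D; linarith
  have hX0 : 0 ≤ X := by linarith
  have hκ0 : 0 ≤ κ := le_trans (by norm_num) (three_le_aknKappa d _)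
  have hm1 : (1 : ℝ) ≤ m := by exact_mod_cast hm
  have hL0 : 0 ≤ L := by rw [hL]; exact div_nonneg (by linarith [Real.log_nonneg hm1]) (Real.sqrt_nonneg _)
  have hBX : B = X ^ d := by rw [hB, hX, card_box]; push_cast; ring
  have hB0 : 0 ≤ B := by rw [hBX]; positivity
  have hEB : E ≤ 2 * d * B := by rw [hE, hB]; exact_mod_cast card_edgesIn_le (d := d) (box d (2 * D + 1))
  have hE0 : 0 ≤ E := by rw [hE]; exact Nat.cast_nonneg _
  have h2dp : (1 : ℝ) ≤ 2 * d * p := by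
    have := hlo; rw [div_le_iff₀ (by positivity)] at this; rw [hp]; linarith
  have hc₀0 : 0 < c₀ := by
    rw [hc₀]; exact mul_pos (mul_pos two_pos hd0) (pow_pos (by positivity) _)
  -- `Rf′ ≤ 5 d³ κ X^{2d} L`
  have hpinv : E / p ≤ E * (2 * d) := by rw [div_le_iff₀ hp0]; nlinarith only [h2dp, hE0]
  have hfac1 : 1 + E / p ≤ 5 * (d : ℝ) ^ 2 * X ^ d := by
    have hd1' : (1 : ℝ) ≤ d := by exact_mod_cast hd1
    have hXd : 1 ≤ X ^ d := one_le_pow₀ hX1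
    have h1 : (1 : ℝ) ≤ (d : ℝ) ^ 2 * X ^ d := by nlinarith only [hd1', hXd]
    calc 1 + E / p ≤ 1 + E * (2 * d) := by linarith only [hpinv]
      _ ≤ 1 + 2 * d * B * (2 * d) := by nlinarith only [hEB, hd0]
      _ = 1 + 4 * (d : ℝ) ^ 2 * X ^ d := by rw [hBX]; ring
      _ ≤ 5 * (d : ℝ) ^ 2 * X ^ d := by linarith only [h1]
  have hSle : S ≤ d * (κ * L) := by
    have hterm : ∀ i : Fin d, μ.real (edgeTwoArms i m) ≤ κ * L := by
      intro i
      have h := real_edgeTwoArms_le_explicit hd1 hδ0 hδ (criticalProbI d) hlo hhi i m hm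
      rw [hκ, hL, ← mul_div_assoc]; exact h
    calc S = ∑ i : Fin d, μ.real (edgeTwoArms i m) := hS
      _ ≤ ∑ _i : Fin d, κ * L := Finset.sum_le_sum fun i _ => hterm i
      _ = d * (κ * L) := by rw [Finset.sum_const, Finset.card_univ, Fintype.card_fin, nsmul_eq_mul]
  have hS0 : 0 ≤ S := by rw [hS]; exact Finset.sum_nonneg fun i _ => measureReal_nonneg
  have hRf : (1 + E / p) * (B * S) ≤ (5 * (d : ℝ) ^ 2 * X ^ d) * (X ^ d * (d * (κ * L))) := by
    have h1 : B * S ≤ X ^ d * (d * (κ * L)) := by rw [hBX]; exact mul_le_mul_of_nonneg_left hSle (by positivity)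
    exact mul_le_mul hfac1 h1 (mul_nonneg hB0 hS0) (by positivity)
  have hRf0 : 0 ≤ (1 + E / p) * (B * S) := mul_nonneg (add_nonneg zero_le_one (div_nonneg hE0 hp0.le)) (mul_nonneg hB0 hS0)
  -- `1/q_c ≤ (2d)^{6d+2} X^{(d-1)(2d)}`
  have hqc_eq : p ^ (d + 2) * (p * ((1 / (2 * (d : ℝ))) / c₀) ^ 2) ^ d = p ^ (2 * d + 2) / (2 * (d : ℝ) * c₀) ^ (2 * d) := by
    rw [div_div, mul_pow, ← pow_mul, one_div_pow, div_eq_mul_one_div (p ^ (2 * d + 2))]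
    ring
  have hP0 : 0 < p ^ (2 * d + 2) := pow_pos hp0 _
  have hqc0 : 0 < p ^ (2 * d + 2) / (2 * (d : ℝ) * c₀) ^ (2 * d) := by positivity
  have hinv : 1 / (p ^ (2 * d + 2) / (2 * (d : ℝ) * c₀) ^ (2 * d)) ≤ (2 * (d : ℝ)) ^ (6 * d + 2) * X ^ ((d - 1) * (2 * d)) := by
    rw [one_div_div]
    have h1 : (2 * (d : ℝ) * c₀) ^ (2 * d) ≤ (2 * (d : ℝ)) ^ (4 * d) * X ^ ((d - 1) * (2 * d)) := by
      rw [hc₀, show 2 * (d : ℝ) * (2 * d * (2 * (D : ℝ) + 1) ^ (d - 1)) = (2 * (d : ℝ)) ^ 2 * (2 * (D : ℝ) + 1) ^ (d - 1) by ring,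
        mul_pow, ← pow_mul, ← pow_mul, show 2 * (2 * d) = 4 * d by ring]
      exact mul_le_mul_of_nonneg_left (pow_le_pow_left₀ (by positivity) (by rw [hX]; linarith) _) (by positivity)
    have h2 : 1 / p ^ (2 * d + 2) ≤ (2 * (d : ℝ)) ^ (2 * d + 2) := by
      rw [div_le_iff₀ hP0, ← mul_pow]; exact one_le_pow₀ h2dp
    calc (2 * (d : ℝ) * c₀) ^ (2 * d) / p ^ (2 * d + 2) = (2 * (d : ℝ) * c₀) ^ (2 * d) * (1 / p ^ (2 * d + 2)) := by
          rw [← mul_one_div]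
      _ ≤ ((2 * (d : ℝ)) ^ (4 * d) * X ^ ((d - 1) * (2 * d))) * (2 * (d : ℝ)) ^ (2 * d + 2) :=
          mul_le_mul h1 h2 (by positivity) (by positivity)
      _ = (2 * (d : ℝ)) ^ (6 * d + 2) * X ^ ((d - 1) * (2 * d)) := by
          rw [show 6 * d + 2 = 4 * d + (2 * d + 2) by ring, pow_add]; ring
  -- exponent bookkeeping
  have hpow : X ^ ((d - 1) * (2 * d)) * X ^ d * X ^ d = X ^ (2 * d ^ 2) := by
    rw [← pow_add, ← pow_add]; congr 1
    obtain ⟨e, rfl⟩ : ∃ e, d = e + 1 := ⟨d - 1, by omega⟩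
    simp only [Nat.add_sub_cancel]; ring
  rw [hqc_eq]
  calc (1 + E / p) * (B * S) / (p ^ (2 * d + 2) / (2 * (d : ℝ) * c₀) ^ (2 * d))
      = (1 + E / p) * (B * S) * (1 / (p ^ (2 * d + 2) / (2 * (d : ℝ) * c₀) ^ (2 * d))) := by rw [← mul_one_div]
    _ ≤ ((5 * (d : ℝ) ^ 2 * X ^ d) * (X ^ d * (d * (κ * L)))) * ((2 * (d : ℝ)) ^ (6 * d + 2) * X ^ ((d - 1) * (2 * d))) :=
        mul_le_mul hRf hinv (by positivity) (by positivity)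
    _ = 5 * (d : ℝ) ^ 3 * (2 * (d : ℝ)) ^ (6 * d + 2) * κ * (X ^ ((d - 1) * (2 * d)) * X ^ d * X ^ d) * L := by ring
    _ = 5 * (d : ℝ) ^ 3 * (2 * (d : ℝ)) ^ (6 * d + 2) * κ * X ^ (2 * d ^ 2) * L := by rw [hpow]

/-! ## The scale bound and (T1) -/

/-- **THE `φ`-PAIR ROUTE AT SCALE `M` (`d ≥ 2`, `M ≥ 64`).**  If every `Λ_D` (`D ≥ 1`) contains `v` with `τ_{p_c}(0,v) ≤ C D^{−b}` (`b > 0`),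
then with `ρ = 1/(4d²+4)`: `P_{p_c}(boxCrossing d 0 (M + ⌊M^ρ⌋ + 1)) ≤ √(2C + K″_d)·M^{−min(b,1)/(8d²+8)}`,
`K″_d = 5√2·d³(2d)^{6d+2}(4d²+4)·7^{2d²}·κ_d`.  Bookkeeping: `D = ⌊M^ρ⌋ ∈ [M^ρ/2, M^ρ]`, `D ≤ √M ≤ M/8`, `m = M − 2D − 2 ≥ M/2`,
`4D+3 ≤ 7M^ρ`, `1 + log m ≤ (4d²+4) m^{ρ}`, `2d²ρ + ρ − 1/2 = −ρ`.
builds on p205010 (kernel theorem, internal audit signed; external expert review pending).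
[cite: Cerf2015, Lemma 6.1 and Lemma 7.1] [cite: DuminilcopinKozmaTassion2020, §7 (38)–(40)] [cite: DuminilCopinTassionEM2016, Thm. 1.1] -/
theorem real_boxCrossing_criticalProbI_le_of_minTwoPoint_pair_crit (hd : 2 ≤ d) {b C : ℝ} (hb0 : 0 < b)
    (hmin : ∀ D : ℕ, 1 ≤ D → ∃ v ∈ box d D, tau d (criticalProbI d) 0 v ≤ C * (D : ℝ) ^ (-b)) {M : ℕ} (hM : 64 ≤ M) :
    (bondPercolation (zdGraph d) (criticalProbI d)).real
        (boxCrossing d 0 (M + ⌊(M : ℝ) ^ (1 / (4 * (d : ℝ) ^ 2 + 4))⌋₊ + 1)) ≤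
      Real.sqrt (2 * C + 5 * Real.sqrt 2 * (d : ℝ) ^ 3 * (2 * (d : ℝ)) ^ (6 * d + 2) * (4 * (d : ℝ) ^ 2 + 4) * 7 ^ (2 * d ^ 2) *
          aknKappa d (1 / (2 * (d : ℝ)))) *
        (M : ℝ) ^ (-(min b 1 / (8 * (d : ℝ) ^ 2 + 8))) := by
  have hd1 : 1 ≤ d := le_trans (by norm_num) hd
  have hd0 : (0 : ℝ) < d := by exact_mod_cast (show 0 < d by omega)
  have hd2 : (2 : ℝ) ≤ d := by exact_mod_cast hd
  have hC0 : 0 ≤ C := const_nonneg_of_minTwoPoint _ hmin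
  set ρ : ℝ := 1 / (4 * (d : ℝ) ^ 2 + 4) with hρ
  set b' : ℝ := min b 1 with hb'
  have hden : (0 : ℝ) < 4 * (d : ℝ) ^ 2 + 4 := by positivity
  have hρ0 : 0 < ρ := by rw [hρ]; positivity
  have hρ1 : ρ ≤ 1 := by rw [hρ, div_le_one hden]; nlinarith
  have hρhalf : ρ ≤ 1 / 2 := by rw [hρ]; exact one_div_le_one_div_of_le (by norm_num) (by nlinarith)
  have hρinv : ρ⁻¹ = 4 * (d : ℝ) ^ 2 + 4 := by rw [hρ, one_div, inv_inv]
  have hb'0 : 0 < b' := lt_min hb0 one_pos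
  have hb'1 : b' ≤ 1 := min_le_right b 1
  have hb'b : b' ≤ b := min_le_left b 1
  have hc : b' / (8 * (d : ℝ) ^ 2 + 8) = ρ * b' / 2 := by rw [hρ]; field_simp; ring
  rw [hc]
  -- the scale `M`
  have hM1 : (1 : ℝ) ≤ M := by exact_mod_cast (show 1 ≤ M by omega)
  have hM0 : (0 : ℝ) < M := by linarith
  have hM64 : (64 : ℝ) ≤ M := by exact_mod_cast hM
  set D : ℕ := ⌊(M : ℝ) ^ ρ⌋₊ with hD
  have hMρ1 : (1 : ℝ) ≤ (M : ℝ) ^ ρ := Real.one_le_rpow hM1 hρ0.le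
  have hMρ0 : (0 : ℝ) < (M : ℝ) ^ ρ := by linarith
  have hD1 : 1 ≤ D := by rw [hD]; exact Nat.le_floor (by simpa using hMρ1)
  have hD1r : (1 : ℝ) ≤ D := by exact_mod_cast hD1
  have hD0r : (0 : ℝ) < D := by linarith
  have hDle : (D : ℝ) ≤ (M : ℝ) ^ ρ := Nat.floor_le (by positivity)
  have hDge : (M : ℝ) ^ ρ / 2 ≤ D := by
    by_cases h2 : (2 : ℝ) ≤ (M : ℝ) ^ ρ
    · have : (M : ℝ) ^ ρ - 1 ≤ D := by
        have := Nat.lt_floor_add_one ((M : ℝ) ^ ρ); rw [← hD] at this; linarith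
      linarith
    · push Not at h2; linarith
  have hsqrt8 : (8 : ℝ) ≤ Real.sqrt M := Real.le_sqrt_of_sq_le (by norm_num; linarith)
  have hDM8 : (D : ℝ) ≤ M / 8 := by
    have h1 : (M : ℝ) ^ ρ ≤ (M : ℝ) ^ (1 / 2 : ℝ) := Real.rpow_le_rpow_of_exponent_le hM1 hρhalf
    rw [← Real.sqrt_eq_rpow] at h1
    have h2 : Real.sqrt M ≤ M / 8 := by
      rw [le_div_iff₀ (by norm_num : (0:ℝ) < 8)]
      nlinarith [Real.sq_sqrt hM0.le, hsqrt8]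
    linarith
  have hDM : 2 * D + 2 ≤ M := by
    have : (8 : ℝ) * D ≤ M := by linarith
    have h' : 8 * D ≤ M := by exact_mod_cast this
    omega
  set m : ℕ := M - 2 * D - 2 with hm
  have hmr : (m : ℝ) = M - 2 * D - 2 := by
    rw [hm, Nat.cast_sub (by omega), Nat.cast_sub (by omega)]; push_cast; ring
  have hmhalf : (M : ℝ) / 2 ≤ m := by rw [hmr]; linarith
  have hm1r : (1 : ℝ) ≤ m := by linarith
  have hm1 : 1 ≤ m := by exact_mod_cast hm1r
  have hm0 : (0 : ℝ) < m := by linarith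
  have hscale : D + (m + D + 2) + D + 1 = M + D + 1 := by omega
  -- the partner and the square inequality
  obtain ⟨v, hv, hτv0⟩ := hmin D hD1
  have hpw := real_boxCrossing_criticalProbI_sq_le_pair_crit_explicit hd hD1 hm1 hv
  rw [hscale] at hpw
  set q := (bondPercolation (zdGraph d) (criticalProbI d)).real (boxCrossing d 0 (M + D + 1)) with hq
  set κ := aknKappa d (1 / (2 * (d : ℝ))) with hκ
  have hκ0 : 0 ≤ κ := le_trans (by norm_num) (three_le_aknKappa d _)
  set X : ℝ := 4 * (D : ℝ) + 3 with hX
  set L : ℝ := (1 + Real.log m) / Real.sqrt m with hL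
  have hX0 : 0 ≤ X := by rw [hX]; positivity
  have hL0 : 0 ≤ L := by rw [hL]; exact div_nonneg (by linarith [Real.log_nonneg hm1r]) (Real.sqrt_nonneg _)
  set A₀ : ℝ := 5 * (d : ℝ) ^ 3 * (2 * (d : ℝ)) ^ (6 * d + 2) with hA₀
  have hA₀0 : 0 ≤ A₀ := by rw [hA₀]; positivity
  -- the two-point term `τ(0,v) ≤ 2C M^{-ρ b'}`
  have hτv : tau d (criticalProbI d) 0 v ≤ 2 * C * (M : ℝ) ^ (-(ρ * b')) := by
    have h2 : (D : ℝ) ^ (-b) ≤ (D : ℝ) ^ (-b') := Real.rpow_le_rpow_of_exponent_le hD1r (by linarith)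
    have h3 : (D : ℝ) ^ (-b') ≤ ((M : ℝ) ^ ρ / 2) ^ (-b') := Real.rpow_le_rpow_of_nonpos (by positivity) hDge (by linarith)
    have h4 : ((M : ℝ) ^ ρ / 2) ^ (-b') = (M : ℝ) ^ (-(ρ * b')) * (2 : ℝ) ^ b' := by
      rw [Real.div_rpow hMρ0.le (by norm_num), ← Real.rpow_mul hM0.le, Real.rpow_neg (by norm_num : (0:ℝ) ≤ 2),
        div_inv_eq_mul]; ring_nf
    have h5 : (2 : ℝ) ^ b' ≤ 2 := by
      conv_rhs => rw [← Real.rpow_one 2]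
      exact Real.rpow_le_rpow_of_exponent_le one_le_two hb'1
    have h6 : 0 ≤ (M : ℝ) ^ (-(ρ * b')) := Real.rpow_nonneg hM0.le _
    calc tau d (criticalProbI d) 0 v ≤ C * (D : ℝ) ^ (-b) := hτv0
      _ ≤ C * (D : ℝ) ^ (-b') := mul_le_mul_of_nonneg_left h2 hC0
      _ ≤ C * (((M : ℝ) ^ ρ / 2) ^ (-b')) := mul_le_mul_of_nonneg_left h3 hC0
      _ = C * ((M : ℝ) ^ (-(ρ * b')) * (2 : ℝ) ^ b') := by rw [h4]
      _ ≤ C * ((M : ℝ) ^ (-(ρ * b')) * 2) := mul_le_mul_of_nonneg_left (mul_le_mul_of_nonneg_left h5 h6) hC0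
      _ = 2 * C * (M : ℝ) ^ (-(ρ * b')) := by ring
  -- the two-arms term `A₀ κ X^{2d²} L ≤ K3 M^{-ρ} ≤ K3 M^{-ρ b'}`
  have hXle : X ≤ 7 * (M : ℝ) ^ ρ := by rw [hX]; linarith
  have hXpow : X ^ (2 * d ^ 2) ≤ (7 : ℝ) ^ (2 * d ^ 2) * (M : ℝ) ^ (ρ * ((2 * d ^ 2 : ℕ) : ℝ)) := by
    calc X ^ (2 * d ^ 2) ≤ (7 * (M : ℝ) ^ ρ) ^ (2 * d ^ 2) := pow_le_pow_left₀ hX0 hXle _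
      _ = (7 : ℝ) ^ (2 * d ^ 2) * ((M : ℝ) ^ ρ) ^ (2 * d ^ 2) := mul_pow _ _ _
      _ = (7 : ℝ) ^ (2 * d ^ 2) * (M : ℝ) ^ (ρ * ((2 * d ^ 2 : ℕ) : ℝ)) := by
          rw [← Real.rpow_natCast ((M : ℝ) ^ ρ), ← Real.rpow_mul hM0.le]
  have hLle : L ≤ (4 * (d : ℝ) ^ 2 + 4) * Real.sqrt 2 * (M : ℝ) ^ (ρ - 1 / 2) := by
    have h1 : 1 + Real.log m ≤ ρ⁻¹ * (m : ℝ) ^ ρ := one_add_log_le_inv_mul_rpow hρ0 hρ1 hm1r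
    have h2 : L ≤ ρ⁻¹ * (m : ℝ) ^ (ρ - 1 / 2) := by
      rw [hL, div_le_iff₀ (Real.sqrt_pos.2 hm0), Real.sqrt_eq_rpow, mul_assoc, ← Real.rpow_add hm0]
      norm_num; exact h1
    have h3 : (m : ℝ) ^ (ρ - 1 / 2) ≤ ((M : ℝ) / 2) ^ (ρ - 1 / 2) :=
      Real.rpow_le_rpow_of_nonpos (by positivity) hmhalf (by linarith)
    have h4 : ((M : ℝ) / 2) ^ (ρ - 1 / 2) = (M : ℝ) ^ (ρ - 1 / 2) * (2 : ℝ) ^ (1 / 2 - ρ) := by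
      rw [Real.div_rpow hM0.le (by norm_num), div_eq_mul_inv, ← Real.rpow_neg (by norm_num : (0:ℝ) ≤ 2), neg_sub]
    have h5 : (2 : ℝ) ^ (1 / 2 - ρ) ≤ Real.sqrt 2 := by
      rw [Real.sqrt_eq_rpow]; exact Real.rpow_le_rpow_of_exponent_le one_le_two (by linarith)
    have h6 : 0 ≤ (M : ℝ) ^ (ρ - 1 / 2) := Real.rpow_nonneg hM0.le _
    calc L ≤ ρ⁻¹ * (m : ℝ) ^ (ρ - 1 / 2) := h2
      _ ≤ ρ⁻¹ * (((M : ℝ) / 2) ^ (ρ - 1 / 2)) := mul_le_mul_of_nonneg_left h3 (inv_nonneg.2 hρ0.le)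
      _ = ρ⁻¹ * ((M : ℝ) ^ (ρ - 1 / 2) * (2 : ℝ) ^ (1 / 2 - ρ)) := by rw [h4]
      _ ≤ ρ⁻¹ * ((M : ℝ) ^ (ρ - 1 / 2) * Real.sqrt 2) :=
          mul_le_mul_of_nonneg_left (mul_le_mul_of_nonneg_left h5 h6) (inv_nonneg.2 hρ0.le)
      _ = (4 * (d : ℝ) ^ 2 + 4) * Real.sqrt 2 * (M : ℝ) ^ (ρ - 1 / 2) := by rw [hρinv]; ring
  have hexp : ρ * ((2 * d ^ 2 : ℕ) : ℝ) + (ρ - 1 / 2) = -ρ := by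
    rw [hρ]; push_cast; field_simp; ring
  set K3 : ℝ := 5 * Real.sqrt 2 * (d : ℝ) ^ 3 * (2 * (d : ℝ)) ^ (6 * d + 2) * (4 * (d : ℝ) ^ 2 + 4) * 7 ^ (2 * d ^ 2) * κ with hK3
  have hK30 : 0 ≤ K3 := by rw [hK3]; exact mul_nonneg (by positivity) hκ0
  have hG : A₀ * κ * X ^ (2 * d ^ 2) * L ≤ K3 * (M : ℝ) ^ (-(ρ * b')) := by
    have h1 : X ^ (2 * d ^ 2) * L ≤ ((7 : ℝ) ^ (2 * d ^ 2) * (M : ℝ) ^ (ρ * ((2 * d ^ 2 : ℕ) : ℝ))) *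
        ((4 * (d : ℝ) ^ 2 + 4) * Real.sqrt 2 * (M : ℝ) ^ (ρ - 1 / 2)) :=
      mul_le_mul hXpow hLle hL0 (by positivity)
    have h2 : (M : ℝ) ^ (ρ * ((2 * d ^ 2 : ℕ) : ℝ)) * (M : ℝ) ^ (ρ - 1 / 2) = (M : ℝ) ^ (-ρ) := by
      rw [← Real.rpow_add hM0, hexp]
    have h3 : (M : ℝ) ^ (-ρ) ≤ (M : ℝ) ^ (-(ρ * b')) :=
      Real.rpow_le_rpow_of_exponent_le hM1 (neg_le_neg (mul_le_of_le_one_right hρ0.le hb'1))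
    calc A₀ * κ * X ^ (2 * d ^ 2) * L = (A₀ * κ) * (X ^ (2 * d ^ 2) * L) := by ring
      _ ≤ (A₀ * κ) * (((7 : ℝ) ^ (2 * d ^ 2) * (M : ℝ) ^ (ρ * ((2 * d ^ 2 : ℕ) : ℝ))) *
            ((4 * (d : ℝ) ^ 2 + 4) * Real.sqrt 2 * (M : ℝ) ^ (ρ - 1 / 2))) := mul_le_mul_of_nonneg_left h1 (mul_nonneg hA₀0 hκ0)
      _ = K3 * ((M : ℝ) ^ (ρ * ((2 * d ^ 2 : ℕ) : ℝ)) * (M : ℝ) ^ (ρ - 1 / 2)) := by rw [hK3, hA₀]; ring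
      _ = K3 * (M : ℝ) ^ (-ρ) := by rw [h2]
      _ ≤ K3 * (M : ℝ) ^ (-(ρ * b')) := mul_le_mul_of_nonneg_left h3 hK30
  -- assembly: `q² ≤ (2C + K3) M^{-ρ b'}`
  have hsq : q ^ 2 ≤ (2 * C + K3) * (M : ℝ) ^ (-(ρ * b')) := by
    calc q ^ 2 ≤ tau d (criticalProbI d) 0 v + A₀ * κ * X ^ (2 * d ^ 2) * L := hpw
      _ ≤ 2 * C * (M : ℝ) ^ (-(ρ * b')) + K3 * (M : ℝ) ^ (-(ρ * b')) := add_le_add hτv hG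
      _ = (2 * C + K3) * (M : ℝ) ^ (-(ρ * b')) := by ring
  have hCK : 0 ≤ 2 * C + K3 := by linarith
  exact le_sqrt_mul_rpow_of_sq_le_gen hM0 hCK hsq

/-- **A DIP IN EVERY BALL ⟹ (T1) BY THE `φ`-PAIR ROUTE** (`d ≥ 2`): if every `Λ_D` contains `v` with `τ_{p_c}(0,v) ≤ C D^{−b}` (`b > 0`),
then `OneArmPolyDecayAtCritical d (min(b,1)/(8d²+8)) (195^{min(b,1)/(8d²+8)} · √(2C + K″_d))`,
`K″_d = 5√2·d³(2d)^{6d+2}(4d²+4)·7^{2d²}·aknKappa d (1/(2d))`.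
builds on p205010 (kernel theorem, internal audit signed; external expert review pending).
[cite: Cerf2015, Lemma 6.1, Lemma 7.1 and §10] [cite: DuminilCopinTassionEM2016, Thm. 1.1] [cite: HeydenreichVanDerHofstad2017, Open Problem 10.1] -/
theorem oneArmPolyDecayAtCritical_of_minTwoPoint_pair_crit (hd : 2 ≤ d) {b C : ℝ} (hb0 : 0 < b)
    (hmin : ∀ D : ℕ, 1 ≤ D → ∃ v ∈ box d D, tau d (criticalProbI d) 0 v ≤ C * (D : ℝ) ^ (-b)) :
    OneArmPolyDecayAtCritical d (min b 1 / (8 * (d : ℝ) ^ 2 + 8))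
      ((195 : ℝ) ^ (min b 1 / (8 * (d : ℝ) ^ 2 + 8)) *
        Real.sqrt (2 * C + 5 * Real.sqrt 2 * (d : ℝ) ^ 3 * (2 * (d : ℝ)) ^ (6 * d + 2) * (4 * (d : ℝ) ^ 2 + 4) * 7 ^ (2 * d ^ 2) *
          aknKappa d (1 / (2 * (d : ℝ))))) := by
  have hd0 : (0 : ℝ) < d := by exact_mod_cast (show 0 < d by omega)
  have hd2 : (2 : ℝ) ≤ d := by exact_mod_cast hd
  have hC0 : 0 ≤ C := const_nonneg_of_minTwoPoint _ hmin
  have hρ0 : (0 : ℝ) < 1 / (4 * (d : ℝ) ^ 2 + 4) := by positivity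
  have hρ1 : 1 / (4 * (d : ℝ) ^ 2 + 4) ≤ 1 := by rw [div_le_one (by positivity)]; nlinarith
  have hc0 : 0 < min b 1 / (8 * (d : ℝ) ^ 2 + 8) := div_pos (lt_min hb0 one_pos) (by positivity)
  set K3 : ℝ := 5 * Real.sqrt 2 * (d : ℝ) ^ 3 * (2 * (d : ℝ)) ^ (6 * d + 2) * (4 * (d : ℝ) ^ 2 + 4) * 7 ^ (2 * d ^ 2) *
      aknKappa d (1 / (2 * (d : ℝ))) with hK3
  have hκ3 : 3 ≤ aknKappa d (1 / (2 * (d : ℝ))) := three_le_aknKappa d _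
  have hK31 : 1 ≤ K3 := by
    rw [hK3]
    have h1 : (1 : ℝ) ≤ Real.sqrt 2 := by
      rw [show (1:ℝ) = Real.sqrt 1 by rw [Real.sqrt_one]]; exact Real.sqrt_le_sqrt (by norm_num)
    have h2 : (1 : ℝ) ≤ (d : ℝ) ^ 3 := one_le_pow₀ (by linarith)
    have h3 : (1 : ℝ) ≤ (2 * (d : ℝ)) ^ (6 * d + 2) := one_le_pow₀ (by linarith)
    have h4 : (1 : ℝ) ≤ 4 * (d : ℝ) ^ 2 + 4 := by nlinarith
    have h5 : (1 : ℝ) ≤ (7 : ℝ) ^ (2 * d ^ 2) := one_le_pow₀ (by norm_num)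
    have h6 : (1 : ℝ) ≤ aknKappa d (1 / (2 * (d : ℝ))) := by linarith
    exact one_le_mul_of_one_le_of_one_le (one_le_mul_of_one_le_of_one_le (one_le_mul_of_one_le_of_one_le
      (one_le_mul_of_one_le_of_one_le (one_le_mul_of_one_le_of_one_le (one_le_mul_of_one_le_of_one_le
      (by norm_num) h1) h2) h3) h4) h5) h6
  have hS : 1 ≤ Real.sqrt (2 * C + K3) := by
    rw [show (1:ℝ) = Real.sqrt 1 by rw [Real.sqrt_one]]
    exact Real.sqrt_le_sqrt (by linarith)
  have h := oneArmPolyDecayAtCritical_of_scaleBound_rpow (d := d) hρ0 hρ1 hc0 hS (M₀ := 64) (by norm_num)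
    (fun M hM => real_boxCrossing_criticalProbI_le_of_minTwoPoint_pair_crit hd hb0 hmin hM)
  have h195 : (3 * (((64 : ℕ) : ℝ) + 1)) = 195 := by norm_num
  rw [h195] at h
  exact h

/-- **X_A ⟹ (T1) BY THE `φ`-PAIR ROUTE** (`d ≥ 2`): `Σ_{z∈Λ_R} τ_{p_c}(0,z) ≤ C R^{d−a}` (`a > 0`, all `R ≥ 1`) gives
`OneArmPolyDecayAtCritical d (min(a,1)/(8d²+8)) (195^{min(a,1)/(8d²+8)}·√(2C + K″_d))` — `d = 3`: exponent **`min(a,1)/80`**, the best X_A row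
of the lane (`/440` packaged zone, `/250` free ε, `≈ /100` Cerf zone with `φ`, `/90` pair + bootstrap); `d = 4, 5, 6`: `/136, /208, /296`.
builds on p205010 (kernel theorem, internal audit signed; external expert review pending).
[cite: Cerf2015, Lemma 6.1, Lemma 7.1 and §10] [cite: DuminilCopinTassionEM2016, Thm. 1.1] [cite: HeydenreichVanDerHofstad2017, Open Problem 10.1] -/
theorem oneArmPolyDecayAtCritical_of_ballTwoPoint_pair_crit (hd : 2 ≤ d) {a C : ℝ} (ha0 : 0 < a)
    (hS : ∀ R : ℕ, 1 ≤ R → ∑ z ∈ box d R, tau d (criticalProbI d) 0 z ≤ C * (R : ℝ) ^ ((d : ℝ) - a)) :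
    OneArmPolyDecayAtCritical d (min a 1 / (8 * (d : ℝ) ^ 2 + 8))
      ((195 : ℝ) ^ (min a 1 / (8 * (d : ℝ) ^ 2 + 8)) *
        Real.sqrt (2 * C + 5 * Real.sqrt 2 * (d : ℝ) ^ 3 * (2 * (d : ℝ)) ^ (6 * d + 2) * (4 * (d : ℝ) ^ 2 + 4) * 7 ^ (2 * d ^ 2) *
          aknKappa d (1 / (2 * (d : ℝ))))) :=
  oneArmPolyDecayAtCritical_of_minTwoPoint_pair_crit hd ha0 (minTwoPoint_of_ballTwoPoint hS)

end Summit.CriticalPhenomena.PercolationContinuityZ3.Theorems.Quant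

end
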